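import Summits.AtomisticToContinuum.Crystallization.Theorems.NashTwoShellGap.Negative.Shape
import Literature.MathematicalPhysics.StatisticalMechanics.LennardJonesThermodynamicLimitProofs

/-!
# `NashTwoShellGap` (stmt-AtomisticToContinuum-16826), negative side II: the certified reach of a refutation

Refuter (cdisprove seat, cycle 1); no definition introduced.  Write `Gap(g)` for the matrix of the crux
(`∀ N x, 1/3-separated → Nash → N·e* + g·#bad ≤ 𝓔_LJ(x)`).
* `neg_stability_le_eStar`: `e* ≥ −2³²/12` — the ONLY lower bound on `e* = ⨅_Q e_LJ(Q)` the tree offers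
  (Fisher–Ruelle stability constant through `E(N)/N → e*`).
* `not_nashGap_of_huge`: consequently `Gap(g)` is refuted exactly for the astronomically large prices
  `g > 2³²/12 − 1/8` (tetrahedron bound `g ≤ −1/8 − e*` of part I), and by nothing in the tree below
  that; the believed optimum is `g_opt ≈ 4·10⁻³`.  The gulf is the missing Kepler-type lower bound on
  periodic Lennard-Jones energies — the common obstruction to proving AND to disproving this crux.
* `violation_squeeze`: a violator of the price `g` is a near-minimiser with dense badness,
  `0 ≤ 𝓔(x) − N·e* < g·#bad(x) ≤ g·N`; certifying an explicit one needs `e*` from below to precision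
  `g·#bad/N`.
All `[folklore]`.
-/

noncomputable section

namespace Summit.AtomisticToContinuum.Crystallization.Theorems.NashTwoShellGapNegative

open scoped BigOperators Classical
open Literature.MathematicalPhysics.StatisticalMechanics Literature.Geometry.DiscreteGeometry
open Summit.AtomisticToContinuum.Crystallization.Theorems.ChargedEnergyGapNegative
open Summit.AtomisticToContinuum.Crystallization.Theorems.CoerciveTwoShellGapNegative

/-- **`e* ≥ −2³²/12`** — the only lower bound on `e*` available in the tree (stability constant,
`neg_mul_le_groundStateEnergy_lennardJones`, through `E(N)/N → e*`). [folklore] -/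
theorem neg_stability_le_eStar : -((65536 : ℝ) ^ 2 / 12) ≤ eStar := by
  have hlim : Filter.Tendsto (fun N : ℕ => groundStateEnergy lennardJones 3 N / N) Filter.atTop
      (nhds eStar) := crysEnergyLimit
  refine ge_of_tendsto hlim (Filter.eventually_atTop.2 ⟨1, fun N hN => ?_⟩)
  have hNr : (0 : ℝ) < N := by exact_mod_cast hN
  rw [le_div_iff₀ hNr]
  have := neg_mul_le_groundStateEnergy_lennardJones (by norm_num : 3 ≤ 5) N
  linarith

/-- **What IS refutable today: astronomically large prices only.**  `Gap(g)` fails for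
`g > 2³²/12 − 1/8` — and for no smaller `g` by anything in the tree. [folklore] -/
theorem not_nashGap_of_huge {g : ℝ} (hg : (65536 : ℝ) ^ 2 / 12 - 1 / 8 < g) :
    ¬ ∀ (N : ℕ) (x : Fin N → E3),
      (∀ i j : Fin N, i ≠ j → (1 / 3 : ℝ) ≤ dist (x i) (x j)) →
      (∀ (i : Fin N) (y : E3), (∀ j : Fin N, j ≠ i → y ≠ x j) →
        siteEnergy lennardJones x i ≤ ∑ j ∈ Finset.univ.erase i, lennardJones (dist y (x j))) →
      (N : ℝ) * eStar + g * (Nat.card {i : Fin N // ¬ IsTwoShellGood (1 / 20) (47 / 50) 1 x i} : ℝ)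
        ≤ interactionEnergy lennardJones x := fun hG => by
  have h1 := g_le_of_nashGap hG
  have h2 := neg_stability_le_eStar
  linarith

/-- **A violator is a near-minimiser with dense badness**: if an injective `x` violates the price `g`,
then `0 ≤ 𝓔(x) − N·e* < g·#bad(x) ≤ g·N`. [folklore] -/
theorem violation_squeeze {g : ℝ} {N : ℕ} {x : Fin N → E3} (hx : Function.Injective x)
    (hlt : interactionEnergy lennardJones x <
      (N : ℝ) * eStar + g * (Nat.card {i : Fin N // ¬ IsTwoShellGood (1 / 20) (47 / 50) 1 x i} : ℝ)) :
    0 ≤ interactionEnergy lennardJones x - (N : ℝ) * eStar ∧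
      interactionEnergy lennardJones x - (N : ℝ) * eStar <
        g * (Nat.card {i : Fin N // ¬ IsTwoShellGood (1 / 20) (47 / 50) 1 x i} : ℝ) ∧
      (Nat.card {i : Fin N // ¬ IsTwoShellGood (1 / 20) (47 / 50) 1 x i} : ℝ) ≤ N :=
  ⟨by linarith [card_mul_eStar_le hx], by linarith, by exact_mod_cast bad_le _ x⟩

/-- **Refutation shape**: `¬ crux` iff for EVERY `g > 0` there is a `1/3`-separated Nash violator
(then squeezed as above). [folklore] -/
theorem not_nashTwoShellGap_iff :
    ¬ Summit.AtomisticToContinuum.Crystallization.Theses.NashClassCertificates.NashTwoShellGap ↔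
      ∀ g : ℝ, 0 < g → ∃ (N : ℕ) (x : Fin N → E3),
        (∀ i j : Fin N, i ≠ j → (1 / 3 : ℝ) ≤ dist (x i) (x j)) ∧
        (∀ (i : Fin N) (y : E3), (∀ j : Fin N, j ≠ i → y ≠ x j) →
          siteEnergy lennardJones x i ≤ ∑ j ∈ Finset.univ.erase i, lennardJones (dist y (x j))) ∧
        interactionEnergy lennardJones x <
          (N : ℝ) * eStar + g * (Nat.card {i : Fin N // ¬ IsTwoShellGood (1 / 20) (47 / 50) 1 x i} : ℝ) := by
  rw [nashTwoShellGap_iff]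
  push Not
  rfl

end Summit.AtomisticToContinuum.Crystallization.Theorems.NashTwoShellGapNegative

end
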